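import Literature.NumberTheory.Automorphic.HilbertRepSpectrumProofs
import HarnessLib

/-!
# The slice of an irreducible representation cut out by a minimal idempotent is irreducible for
# the complementary subgroup
(Gelbart, *Automorphic forms on adele groups* (1975), §10, p. 152: "`M' = ⊕ {⊗_{v ∈ S} u'_v} ⊗
{⊗_{v ∉ S} V'^j_v}` […] the group `G'_S` now acts irreducibly on `M'`"; Jacquet–Langlands (1970),
§16, p. 503)

Topic `NumberTheory/Automorphic`; theorems only (no definition, no named fact, no instance),
sibling of `HilbertRepSpectrumProofs`. In the proof of the Jacquet–Langlands correspondence and of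
multiplicity one for the multiplicative group `G' = D^×` of a division quaternion algebra (Gelbart
Thm. 10.5, Thm. 10.10; the tree's `multiplicity_one_quaternionUnits`), an irreducible constituent
`π' ⊆ L²(G'_F \ G'_𝔸)` of `G'_𝔸 = G'_S × G'^S` is cut down, by the idempotent
`ξ_S = ⊗_{v ∈ S} d(π'_v) \overline{⟨π'_v(·) u'_v, u'_v⟩}` (orthogonality relations (10.11)), to the
slice `{⊗ u'_v} ⊗ π'^S` on which `G'^S` acts **irreducibly** — this irreducibility is what the
abstract transport of multiplicities (`HilbertRepTraceComparisonMultiplicity`,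
`exists_isometry_into_of_hilbertSchmidt_le_relative`: irreducibility under the groups `G_v`,
`v ∉ S`, together with the operators `R'(Φ'_f)`) consumes on the quaternion side. This file proves
the underlying lemma of representation theory in a form free of tensor products, compact groups
and Haar measure:

* `ClosedSubrep.mem_of_isTopIrreducible_of_slice` — let `π` be a representation of a group `Γ`
  by bounded operators on a Hilbert space, `W` a topologically irreducible closed invariant
  subspace, `K, G ⊆ Γ` subsets with `Γ = K · G`, and `E` a bounded operator. Let `V ≠ 0` be a
  closed subspace of `W`, stable under `π(G)`, on which **`E π(k) v = c(k) v`** for all `k ∈ K`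
  (the relation `E π(k) E = c(k) E` of a minimal idempotent `E = π(ξ)`, `c(k) = ⟨τ(k) u, u⟩`, on
  `E`-fixed vectors). Then `V` contains every `E`-fixed vector of `W`. Proof: the closed span `N`
  of `π(Γ) V` is a non-zero closed invariant subspace of `W`, hence `N = W`
  (`eq_of_le_of_isTopIrreducible`); and `E(N) ⊆ V`, because `E π(k g) v = E π(k) (π(g) v) =
  c(k) π(g) v ∈ V` on generators, by linearity on the span and by continuity on its closure; so an
  `E`-fixed `x ∈ W = N` satisfies `x = E x ∈ V`.
* `ClosedSubrep.slice_eq_bot_or_eq` — consequently **the slice `σ = {x ∈ W : E x = x}` is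
  irreducible under `π(G)`**: a closed `π(G)`-stable subspace of `σ` is `0` or `σ` (the shape of the
  irreducibility hypotheses of `HilbertRepTraceComparisonMultiplicity`, any further operators
  preserving the subspace being harmless).

In the application `Γ = D_𝔸ˣ`, `K = D_Sˣ` (or its norm-one subgroup), `G = G'^S`, `E = R'(ξ_S)`,
and the relation `E R'(k) E = ⟨π'_S(k) u'_S, u'_S⟩ E` is Schur orthogonality for the compact group
`D_Sˣ / K_Sˣ` (Gelbart (10.11)); that input, like the trace formulas, is not treated here. Part of
the inline (D-0026) decomposition of
`Literature.NumberTheory.Automorphic.multiplicity_one_quaternionUnits` (Gelbart Thm. 10.10).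

## References

* S. Gelbart, *Automorphic forms on adele groups*, Ann. of Math. Studies 83 (1975), §10,
  pp. 151–153 and (10.11) [Gelbart1975].
* H. Jacquet, R. P. Langlands, *Automorphic forms on `GL(2)`*, LNM 114 (1970), §16, pp. 502–503
  [JacquetLanglands1970].
-/

noncomputable section

open Topology

namespace ContRepresentation

variable {Γ H : Type*} [Group Γ] [NormedAddCommGroup H] [InnerProductSpace ℂ H]

/-- **A non-zero closed `π(G)`-stable subspace of an irreducible `W` on which `E π(k)` acts by
scalars contains all `E`-fixed vectors of `W`** (`Γ = K · G`). See the module docstring; this is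
the tensor-product-free content of "the group `G'_S` acts irreducibly on
`{⊗_{v ∈ S} u'_v} ⊗ {⊗_{v ∉ S} V'_v}`" (Gelbart (1975), p. 152).
[cite: Gelbart1975, §10, p. 152; JacquetLanglands1970, §16, p. 503] -/
theorem ClosedSubrep.mem_of_isTopIrreducible_of_slice {π : ContRepresentation ℂ Γ H}
    {W : ClosedSubrep π} (hW : W.toContRep.IsTopIrreducible) (E : H →L[ℂ] H)
    (Kset Gset : Set Γ) (hgen : ∀ γ : Γ, ∃ k ∈ Kset, ∃ g ∈ Gset, γ = k * g) (c : Γ → ℂ)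
    (V : Submodule ℂ H) (hVc : IsClosed (V : Set H)) (hVW : V ≤ W.toSubmodule) (hV0 : V ≠ ⊥)
    (hVG : ∀ g ∈ Gset, ∀ x ∈ V, π g x ∈ V)
    (hEK : ∀ k ∈ Kset, ∀ y ∈ V, E (π k y) = c k • y) :
    ∀ x ∈ W, E x = x → x ∈ V := by
  -- the `Γ`-orbit of `V` and its closed span `N`
  set S : Set H := {x | ∃ γ : Γ, ∃ v ∈ V, x = π γ v} with hS
  set N : Submodule ℂ H := (Submodule.span ℂ S).topologicalClosure with hN
  have hSinv : ∀ (γ₀ : Γ), ∀ x ∈ S, π γ₀ x ∈ S := by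
    rintro γ₀ _ ⟨γ, v, hv, rfl⟩
    exact ⟨γ₀ * γ, v, hv, by rw [map_mul]; rfl⟩
  have hspan_inv : ∀ (γ₀ : Γ), ∀ x ∈ Submodule.span ℂ S, π γ₀ x ∈ Submodule.span ℂ S := by
    intro γ₀ x hx
    have h : (Submodule.span ℂ S).map (π γ₀ : H →ₗ[ℂ] H) ≤ Submodule.span ℂ S := by
      rw [Submodule.map_span]
      refine Submodule.span_mono ?_
      rintro _ ⟨y, hy, rfl⟩
      exact hSinv γ₀ y hy
    exact h ⟨x, hx, rfl⟩
  have hN_inv : ∀ (γ₀ : Γ), ∀ x ∈ N, π γ₀ x ∈ N := by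
    intro γ₀ x hx
    have hmaps : Set.MapsTo (π γ₀) (Submodule.span ℂ S : Set H) (Submodule.span ℂ S : Set H) :=
      fun y hy => hspan_inv γ₀ y hy
    have hcl := hmaps.closure (π γ₀).continuous
    rw [← Submodule.topologicalClosure_coe] at hcl
    exact hcl hx
  let N' : ClosedSubrep π :=
    { toSubmodule := N
      apply_mem_toSubmodule := fun γ x hx => hN_inv γ x hx
      isClosed' := Submodule.isClosed_topologicalClosure _ }
  -- `V ≤ N ≤ W`
  have hVN : V ≤ N := fun v hv =>
    Submodule.le_topologicalClosure _ (Submodule.subset_span ⟨1, v, hv, by rw [map_one]; rfl⟩)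
  have hSW : S ⊆ W.toSubmodule := by
    rintro _ ⟨γ, v, hv, rfl⟩
    exact W.apply_mem γ (hVW hv)
  have hNW : N ≤ W.toSubmodule := by
    rw [hN]
    exact (Submodule.span ℂ S).topologicalClosure_minimal (Submodule.span_le.2 hSW) W.isClosed
  have hN'W : N' ≤ W := fun x hx => hNW hx
  -- `N' = W` by irreducibility
  have hnt : Nontrivial N'.toSubmodule := by
    obtain ⟨v, hv, hv0⟩ := (Submodule.ne_bot_iff V).1 hV0
    exact ⟨⟨⟨v, hVN hv⟩, 0, fun h => hv0 (congrArg Subtype.val h)⟩⟩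
  have hN'eq : N' = W := ClosedSubrep.eq_of_le_of_isTopIrreducible hW hnt hN'W
  -- `E(N) ⊆ V`
  have hES : ∀ x ∈ S, E x ∈ V := by
    rintro _ ⟨γ, v, hv, rfl⟩
    obtain ⟨k, hk, g, hg, rfl⟩ := hgen γ
    rw [map_mul]
    change E (π k (π g v)) ∈ V
    rw [hEK k hk _ (hVG g hg v hv)]
    exact V.smul_mem _ (hVG g hg v hv)
  have hEspan : ∀ x ∈ Submodule.span ℂ S, E x ∈ V := by
    intro x hx
    induction hx using Submodule.span_induction with
    | mem y hy => exact hES y hy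
    | zero => rw [map_zero]; exact V.zero_mem
    | add y z _ _ hy hz => rw [map_add]; exact V.add_mem hy hz
    | smul a y _ hy => rw [map_smul]; exact V.smul_mem a hy
  have hEN : ∀ x ∈ N, E x ∈ V := by
    intro x hx
    have hsub : closure (Submodule.span ℂ S : Set H) ⊆ E ⁻¹' (V : Set H) :=
      closure_minimal (fun y hy => hEspan y hy) (hVc.preimage E.continuous)
    rw [hN, ← Submodule.mem_toAddSubmonoid] at hx
    have hx' : x ∈ closure (Submodule.span ℂ S : Set H) := by
      rw [← Submodule.topologicalClosure_coe]
      exact hx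
    exact hsub hx'
  -- conclusion
  intro x hx hEx
  have hxN : x ∈ N := by
    have : x ∈ N' := by
      rw [hN'eq]
      exact hx
    exact this
  rw [← hEx]
  exact hEN x hxN

/-- **The `E`-fixed slice of an irreducible closed invariant subspace is irreducible under the
complementary subgroup.** With `π`, `W`, `K`, `G`, `E`, `c` as in
`ClosedSubrep.mem_of_isTopIrreducible_of_slice`, assume `E π(k) y = c(k) y` for all `k ∈ K` and all
`E`-fixed `y ∈ W`, and let `σ = {x ∈ W : E x = x}`. Then every closed `π(G)`-stable subspace of
`σ` is `0` or `σ` (Gelbart (1975), p. 152: "the group `G'_S` now acts irreducibly on `M'`", for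
one constituent). [cite: Gelbart1975, §10, p. 152; JacquetLanglands1970, §16, p. 503] -/
theorem ClosedSubrep.slice_eq_bot_or_eq {π : ContRepresentation ℂ Γ H}
    {W : ClosedSubrep π} (hW : W.toContRep.IsTopIrreducible) (E : H →L[ℂ] H)
    (Kset Gset : Set Γ) (hgen : ∀ γ : Γ, ∃ k ∈ Kset, ∃ g ∈ Gset, γ = k * g) (c : Γ → ℂ)
    (hEK : ∀ k ∈ Kset, ∀ y ∈ W, E y = y → E (π k y) = c k • y)
    (σ : Submodule ℂ H) (hσ : ∀ x, x ∈ σ ↔ x ∈ W ∧ E x = x)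
    (V : Submodule ℂ H) (hVc : IsClosed (V : Set H)) (hVσ : V ≤ σ)
    (hVG : ∀ g ∈ Gset, ∀ x ∈ V, π g x ∈ V) :
    V = ⊥ ∨ V = σ := by
  by_cases hV0 : V = ⊥
  · exact Or.inl hV0
  right
  refine le_antisymm hVσ fun x hx => ?_
  have hVW : V ≤ W.toSubmodule := fun v hv => ((hσ v).1 (hVσ hv)).1
  have hEK' : ∀ k ∈ Kset, ∀ y ∈ V, E (π k y) = c k • y := fun k hk y hy =>
    hEK k hk y (hVW hy) ((hσ y).1 (hVσ hy)).2
  exact ClosedSubrep.mem_of_isTopIrreducible_of_slice hW E Kset Gset hgen c V hVc hVW hV0 hVG hEK'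
    x ((hσ x).1 hx).1 ((hσ x).1 hx).2

end ContRepresentation
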